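import Literature.NumberTheory.Connes2026.AnnulusMainTermHS
import Literature.NumberTheory.Connes2026.ScalingOpDixmierMalliavin
import HarnessLib

/-!
# Connes 1999 Thm VII.4, `k = ℚ`, `S = {∞, p}` — THE SHELL-LOCALISED PART `ϑ(g) Q Y` OF THE ONE-PARAMETER
# FAMILY: Dixmier–Malliavin splitting `ϑ(g) Q Y = Σ_r ϑ(f_r) Q' ϑ(ψ_r) Q Y`, and its properties (W0)–(W2)

LABEL (line 1): RH-FREE literature (theorems only; NO definition, NO named fact).  bears_on: LADDER-RH
W-C/W-P (C1 named-fact debt), cell `rh-crit`, sub-cell cc, overflow row O1 — twelfth file of the "annulus road"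
under `Connes1999_thm_VII_4_rat`.  WHAT THIS IS NOT: any claim about positivity, Weil's criterion or RH.

Sources.  A. Connes, Selecta Math. 5 (1999) [`Connes1999`], §VII proof of Thm 4 (29)–(33) (held text
`paper:arxiv-math_9811068`, p0013); J. Dixmier, P. Malliavin (1978) §3 Thm. 3.1 [`DixmierMalliavin1978`];
M. Reed, B. Simon (1972) [`ReedSimon1972`], Thm. VI.22, VI.24.

## What is proved

For a smooth compactly supported `g`, a shell `Q = Q_{a,b}` (`0 < a ≤ b`):

* `exists_support_radius` — a compactly supported `h` vanishes outside some `[−r, r]`;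
  `scalingOp_mul_shellProj_eq` — `ϑ(h) Q = Q̃ ϑ(h) Q` with `Q̃ = Q_{ae^{−r}, be^{r}}` (support propagation);
* **`exists_scalingOp_shellProj_eq_sum`** — there are `N`, continuous compactly supported `f_r, ψ_r` and
  `R ≥ 0` with `ϑ(g) Q Y = Σ_{r<N} ϑ(f_r) Q_{ae^{−R}, be^{R}} ϑ(ψ_r) Q Y` for EVERY bounded `Y`;
* hence, along Hilbert bases `(f_i)` of `L²(ℝ)_ev` and for every bounded `Y`, `K`:
  **`exists_bound_tsum_norm_inner_scalingOp_shellProj`** (W1-type: `Σ_i |⟨f_i, ϑ(g) Q Y f_i⟩| ≤ C ‖Y‖`, `C`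
  independent of `Y` and of the basis), **`tsum_inner_scalingOp_shellProj_eq_of_hilbertBasis`** (W0-type),
  **`tendsto_tsum_inner_scalingOp_shellProj_dualCutoff`** (W2-type: `Σ_i ⟨f_i, ϑ(g) Q P̂⁰_M K f_i⟩ →
  Σ_i ⟨f_i, ϑ(g) Q K f_i⟩` as `M → ∞`).

With `Q = Q_{1/p,1}… ` no: with `Q` a shell containing `e^{±R}`-neighbourhoods as needed and `K = Q₀(1) ϑ_{m log p}`,
these are (W0)–(W2) of `AnnulusCorrectionLimit` for the SHELL-LOCALISED part `ϑ(g) Q P̂⁰_M Q₀(1) ϑ_{m log p}` of the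
one-parameter family; the complementary part `ϑ(g) (1 − Q) P̂⁰_M Q₀(1) ϑ_{m log p}` (separated sinc kernel) and the
VALUE of the limit remain.

No instance, notation or attribute; no `def`.
-/

noncomputable section

open _root_.MeasureTheory Complex Set Filter
open scoped Real Topology ComplexConjugate ENNReal InnerProductSpace

namespace Literature.NumberTheory.Connes2026

open Literature.NumberTheory.LFunctions Literature.Analysis.OperatorTheory
open Literature.NumberTheory.ConnesConsani
open Literature.NumberTheory.ConnesConsani2024
open Literature.NumberTheory.ConnesConsani2021 hiding cutoffProj cutoffProj_coeFn

/-! ## §1. Support radius and support propagation -/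

/-- A compactly supported function on `ℝ` vanishes outside some `[−r, r]`, `r ≥ 0`. [folklore] -/
private theorem exists_support_radius {h : ℝ → ℂ} (hh : HasCompactSupport h) :
    ∃ r : ℝ, 0 ≤ r ∧ ∀ τ, r < |τ| → h τ = 0 := by
  obtain ⟨r, hr⟩ := (hh.isCompact.isBounded).subset_closedBall 0
  refine ⟨max r 0, le_max_right _ _, fun τ hτ => image_eq_zero_of_notMem_tsupport fun hmem => ?_⟩
  have h1 := hr hmem
  rw [Metric.mem_closedBall, dist_zero_right, Real.norm_eq_abs] at h1
  exact absurd (h1.trans (le_max_left r 0)) (not_le.mpr hτ)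

/-- **Support propagation**: `ϑ(h) Q_{a,b} = Q_{ae^{−r}, be^{r}} ϑ(h) Q_{a,b}` when `h ∈ L¹` vanishes outside
`[−r, r]`. [cite: Connes1999, §VII proof of Thm 4 eqs. (30)–(33) (arXiv p0013)] -/
theorem scalingOp_mul_shellProj_eq {h : ℝ → ℂ} {r a b : ℝ} (ha : 0 ≤ a) (hab : a ≤ b) (hint : Integrable h)
    (hsupp : ∀ τ, r < |τ| → h τ = 0) :
    scalingOp h * shellProj a b = shellProj (a * Real.exp (-r)) (b * Real.exp r) * (scalingOp h * shellProj a b) := by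
  have h0 := one_sub_shellProj_mul_scalingOp_mul_shellProj ha hab hint hsupp
  rw [sub_mul, sub_mul, one_mul, sub_eq_zero, mul_assoc] at h0
  exact h0

/-! ## §2. The Dixmier–Malliavin splitting of `ϑ(g) Q Y` -/

/-- **`ϑ(g) Q Y = Σ_r ϑ(f_r) Q' ϑ(ψ_r) Q Y`** for every bounded `Y`, with continuous compactly supported
`f_r, ψ_r` and ONE enlarged shell `Q' = Q_{ae^{−R}, be^{R}}` (Dixmier–Malliavin `ϑ(g) = Σ ϑ(f_r)ϑ(ψ_r)` and
support propagation for each `ψ_r`). [cite: DixmierMalliavin1978, §3 Thm. 3.1; Connes1999, §VII proof of Thm 4 eqs. (30)–(33) (arXiv p0013)] -/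
theorem exists_scalingOp_shellProj_eq_sum {g : ℝ → ℂ} (hg : ContDiff ℝ (⊤ : ℕ∞) g) (hgs : HasCompactSupport g)
    {a b : ℝ} (ha : 0 ≤ a) (hab : a ≤ b) :
    ∃ (N : ℕ) (f ψ : Fin N → ℝ → ℂ) (R : ℝ), 0 ≤ R ∧
      (∀ r, Continuous (f r) ∧ HasCompactSupport (f r)) ∧
      (∀ r, Continuous (ψ r) ∧ HasCompactSupport (ψ r)) ∧
      ∀ Y : Lp ℂ 2 (volume : Measure ℝ) →L[ℂ] Lp ℂ 2 (volume : Measure ℝ),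
        scalingOp g ∘L (shellProj a b ∘L Y) =
          ∑ r, scalingOp (f r) ∘L shellProj (a * Real.exp (-R)) (b * Real.exp R) ∘L
            (scalingOp (ψ r) ∘L shellProj a b ∘L Y) := by
  obtain ⟨N, f, ψ, hf, hψ, hsum⟩ := exists_scalingOp_eq_sum_comp hg hgs
  -- a common support radius for the `ψ_r`
  choose ρ hρ0 hρ using fun r => exists_support_radius (hψ r).2
  refine ⟨N, f, ψ, ∑ r, ρ r, Finset.sum_nonneg fun r _ => hρ0 r,
    fun r => ⟨(hf r).1.continuous, (hf r).2⟩, fun r => ⟨(hψ r).1.continuous, (hψ r).2⟩, fun Y => ?_⟩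
  have hR : ∀ r τ, (∑ r', ρ r') < |τ| → ψ r τ = 0 := fun r τ hτ =>
    hρ r τ ((Finset.single_le_sum (fun r' _ => hρ0 r') (Finset.mem_univ r)).trans_lt hτ)
  have hprop : ∀ r, scalingOp (ψ r) * shellProj a b =
      shellProj (a * Real.exp (-(∑ r', ρ r'))) (b * Real.exp (∑ r', ρ r')) * (scalingOp (ψ r) * shellProj a b) :=
    fun r => scalingOp_mul_shellProj_eq ha hab ((hψ r).1.continuous.integrable_of_hasCompactSupport (hψ r).2) (hR r)
  rw [hsum]
  change (∑ r, scalingOp (f r) * scalingOp (ψ r)) * (shellProj a b * Y) =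
    ∑ r, scalingOp (f r) * (shellProj (a * Real.exp (-(∑ r', ρ r'))) (b * Real.exp (∑ r', ρ r')) *
      (scalingOp (ψ r) * (shellProj a b * Y)))
  rw [Finset.sum_mul]
  refine Finset.sum_congr rfl fun r _ => ?_
  have h1 : scalingOp (f r) * scalingOp (ψ r) * (shellProj a b * Y) =
      scalingOp (f r) * (scalingOp (ψ r) * shellProj a b) * Y := by simp only [mul_assoc]
  rw [h1, hprop r]
  simp only [mul_assoc]

/-! ## §3. (W0)–(W2) for the shell-localised family -/

section Properties

variable {g : ℝ → ℂ} (hg : ContDiff ℝ (⊤ : ℕ∞) g) (hgs : HasCompactSupport g) {a b : ℝ} (ha : 0 < a) (hab : a ≤ b)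

include hg hgs ha hab

/-- **(W1-type) A uniform absolute bound**: there is `C` (depending on `g` and the shell only) such that for
every bounded `Y` and every Hilbert basis `(f_i)` of `L²(ℝ)_ev` the diagonal series of `ϑ(g) Q Y` is absolutely
summable with `Σ_i |⟨f_i, ϑ(g) Q Y f_i⟩| ≤ C ‖Y‖`. [cite: Connes1999, §VII proof of Thm 4 eqs. (29)–(33) (arXiv p0013); ReedSimon1972, Thm. VI.22 (c), (f), PDF p. 198] -/
theorem exists_bound_tsum_norm_inner_scalingOp_shellProj :
    ∃ C : ℝ, 0 ≤ C ∧ ∀ (Y : Lp ℂ 2 (volume : Measure ℝ) →L[ℂ] Lp ℂ 2 (volume : Measure ℝ)) (ι : Type)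
      (f : HilbertBasis ι ℂ (evenPart : Submodule ℂ (Lp ℂ 2 (volume : Measure ℝ)))),
      Summable (fun i => ‖⟪((f i : evenPart) : Lp ℂ 2 (volume : Measure ℝ)),
        (scalingOp g ∘L (shellProj a b ∘L Y)) ((f i : evenPart) : Lp ℂ 2 (volume : Measure ℝ))⟫_ℂ‖) ∧
      ∑' i, ‖⟪((f i : evenPart) : Lp ℂ 2 (volume : Measure ℝ)),
        (scalingOp g ∘L (shellProj a b ∘L Y)) ((f i : evenPart) : Lp ℂ 2 (volume : Measure ℝ))⟫_ℂ‖ ≤ C * ‖Y‖ := by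
  obtain ⟨N, f, ψ, R, hR0, hf, hψ, hdec⟩ := exists_scalingOp_shellProj_eq_sum hg hgs ha.le hab
  have ha' : 0 < a * Real.exp (-R) := mul_pos ha (Real.exp_pos _)
  have hab' : a * Real.exp (-R) ≤ b * Real.exp R :=
    (mul_le_mul_of_nonneg_right hab (Real.exp_pos _).le).trans
      (mul_le_mul_of_nonneg_left (Real.exp_le_exp.mpr (by linarith)) (ha.le.trans hab))
  refine ⟨∑ r, Real.sqrt (∫ v, ∫ y, ‖shellScalingKernel (f r) (a * Real.exp (-R)) (b * Real.exp R) v y‖ ^ 2) *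
      Real.sqrt (∫ v, ∫ y, ‖shellScalingKernel (ψ r) a b v y‖ ^ 2),
    Finset.sum_nonneg fun r _ => mul_nonneg (Real.sqrt_nonneg _) (Real.sqrt_nonneg _), fun Y ι b' => ?_⟩
  have hterm := fun r => summable_norm_inner_mainTerm (hf r).1 (hf r).2 (hψ r).1 (hψ r).2 ha hab ha' hab' Y b'
  -- the diagonal coefficient is the finite sum of the main-term coefficients
  have hsplit : ∀ i, ⟪((b' i : evenPart) : Lp ℂ 2 (volume : Measure ℝ)),
      (scalingOp g ∘L (shellProj a b ∘L Y)) ((b' i : evenPart) : Lp ℂ 2 (volume : Measure ℝ))⟫_ℂ =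
      ∑ r, ⟪((b' i : evenPart) : Lp ℂ 2 (volume : Measure ℝ)),
        (scalingOp (f r) ∘L shellProj (a * Real.exp (-R)) (b * Real.exp R) ∘L
          (scalingOp (ψ r) ∘L shellProj a b ∘L Y)) ((b' i : evenPart) : Lp ℂ 2 (volume : Measure ℝ))⟫_ℂ := fun i => by
    rw [hdec Y, sum_apply, inner_sum]
  simp_rw [hsplit]
  have hsumm : Summable fun i => ∑ r, ‖⟪((b' i : evenPart) : Lp ℂ 2 (volume : Measure ℝ)),
      (scalingOp (f r) ∘L shellProj (a * Real.exp (-R)) (b * Real.exp R) ∘L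
        (scalingOp (ψ r) ∘L shellProj a b ∘L Y)) ((b' i : evenPart) : Lp ℂ 2 (volume : Measure ℝ))⟫_ℂ‖ :=
    summable_sum fun r _ => (hterm r).1
  have hnorm : ∀ i, ‖∑ r, ⟪((b' i : evenPart) : Lp ℂ 2 (volume : Measure ℝ)),
        (scalingOp (f r) ∘L shellProj (a * Real.exp (-R)) (b * Real.exp R) ∘L
          (scalingOp (ψ r) ∘L shellProj a b ∘L Y)) ((b' i : evenPart) : Lp ℂ 2 (volume : Measure ℝ))⟫_ℂ‖ ≤
      ∑ r, ‖⟪((b' i : evenPart) : Lp ℂ 2 (volume : Measure ℝ)),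
        (scalingOp (f r) ∘L shellProj (a * Real.exp (-R)) (b * Real.exp R) ∘L
          (scalingOp (ψ r) ∘L shellProj a b ∘L Y)) ((b' i : evenPart) : Lp ℂ 2 (volume : Measure ℝ))⟫_ℂ‖ :=
    fun i => norm_sum_le Finset.univ _
  have hs1 : Summable fun i => ‖∑ r, ⟪((b' i : evenPart) : Lp ℂ 2 (volume : Measure ℝ)),
        (scalingOp (f r) ∘L shellProj (a * Real.exp (-R)) (b * Real.exp R) ∘L
          (scalingOp (ψ r) ∘L shellProj a b ∘L Y)) ((b' i : evenPart) : Lp ℂ 2 (volume : Measure ℝ))⟫_ℂ‖ :=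
    Summable.of_nonneg_of_le (fun _ => norm_nonneg _) hnorm hsumm
  refine ⟨hs1, ?_⟩
  have h2 : ∑' i, ‖∑ r, ⟪((b' i : evenPart) : Lp ℂ 2 (volume : Measure ℝ)),
        (scalingOp (f r) ∘L shellProj (a * Real.exp (-R)) (b * Real.exp R) ∘L
          (scalingOp (ψ r) ∘L shellProj a b ∘L Y)) ((b' i : evenPart) : Lp ℂ 2 (volume : Measure ℝ))⟫_ℂ‖ ≤
      ∑' i, ∑ r, ‖⟪((b' i : evenPart) : Lp ℂ 2 (volume : Measure ℝ)),
        (scalingOp (f r) ∘L shellProj (a * Real.exp (-R)) (b * Real.exp R) ∘L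
          (scalingOp (ψ r) ∘L shellProj a b ∘L Y)) ((b' i : evenPart) : Lp ℂ 2 (volume : Measure ℝ))⟫_ℂ‖ :=
    hs1.tsum_le_tsum hnorm hsumm
  refine h2.trans ?_
  have h3 : (∑' i, ∑ r, ‖⟪((b' i : evenPart) : Lp ℂ 2 (volume : Measure ℝ)),
        (scalingOp (f r) ∘L shellProj (a * Real.exp (-R)) (b * Real.exp R) ∘L
          (scalingOp (ψ r) ∘L shellProj a b ∘L Y)) ((b' i : evenPart) : Lp ℂ 2 (volume : Measure ℝ))⟫_ℂ‖) =
      ∑ r, ∑' i, ‖⟪((b' i : evenPart) : Lp ℂ 2 (volume : Measure ℝ)),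
        (scalingOp (f r) ∘L shellProj (a * Real.exp (-R)) (b * Real.exp R) ∘L
          (scalingOp (ψ r) ∘L shellProj a b ∘L Y)) ((b' i : evenPart) : Lp ℂ 2 (volume : Measure ℝ))⟫_ℂ‖ :=
    Summable.tsum_finsetSum fun r _ => (hterm r).1
  rw [h3, Finset.sum_mul]
  refine Finset.sum_le_sum fun r _ => ((hterm r).2).trans (le_of_eq ?_)
  rw [mul_assoc, mul_comm ‖Y‖]

/-- **(W0-type) Basis independence**: the diagonal series of `ϑ(g) Q Y` along Hilbert bases of `L²(ℝ)_ev`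
does not depend on the basis. [cite: ReedSimon1972, Thm. VI.24, PDF p. 199] -/
theorem tsum_inner_scalingOp_shellProj_eq_of_hilbertBasis
    (Y : Lp ℂ 2 (volume : Measure ℝ) →L[ℂ] Lp ℂ 2 (volume : Measure ℝ)) {ι ι' : Type*}
    (f₁ : HilbertBasis ι ℂ (evenPart : Submodule ℂ (Lp ℂ 2 (volume : Measure ℝ))))
    (f₂ : HilbertBasis ι' ℂ (evenPart : Submodule ℂ (Lp ℂ 2 (volume : Measure ℝ)))) :
    ∑' i, ⟪((f₁ i : evenPart) : Lp ℂ 2 (volume : Measure ℝ)),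
        (scalingOp g ∘L (shellProj a b ∘L Y)) ((f₁ i : evenPart) : Lp ℂ 2 (volume : Measure ℝ))⟫_ℂ =
      ∑' i, ⟪((f₂ i : evenPart) : Lp ℂ 2 (volume : Measure ℝ)),
        (scalingOp g ∘L (shellProj a b ∘L Y)) ((f₂ i : evenPart) : Lp ℂ 2 (volume : Measure ℝ))⟫_ℂ := by
  obtain ⟨N, f, ψ, R, hR0, hf, hψ, hdec⟩ := exists_scalingOp_shellProj_eq_sum hg hgs ha.le hab
  have ha' : 0 < a * Real.exp (-R) := mul_pos ha (Real.exp_pos _)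
  have hab' : a * Real.exp (-R) ≤ b * Real.exp R :=
    (mul_le_mul_of_nonneg_right hab (Real.exp_pos _).le).trans
      (mul_le_mul_of_nonneg_left (Real.exp_le_exp.mpr (by linarith)) (ha.le.trans hab))
  have hsplit : ∀ (x : Lp ℂ 2 (volume : Measure ℝ)),
      ⟪x, (scalingOp g ∘L (shellProj a b ∘L Y)) x⟫_ℂ =
      ∑ r, ⟪x, (scalingOp (f r) ∘L shellProj (a * Real.exp (-R)) (b * Real.exp R) ∘L
          (scalingOp (ψ r) ∘L shellProj a b ∘L Y)) x⟫_ℂ :=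
    fun x => by rw [hdec Y, sum_apply, inner_sum]
  simp_rw [hsplit]
  have h1 := fun r => (summable_norm_inner_mainTerm (hf r).1 (hf r).2 (hψ r).1 (hψ r).2 ha hab ha' hab' Y f₁).1
  have h2 := fun r => (summable_norm_inner_mainTerm (hf r).1 (hf r).2 (hψ r).1 (hψ r).2 ha hab ha' hab' Y f₂).1
  rw [Summable.tsum_finsetSum fun r _ => Summable.of_norm (h1 r),
    Summable.tsum_finsetSum fun r _ => Summable.of_norm (h2 r)]
  exact Finset.sum_congr rfl fun r _ =>
    tsum_inner_mainTerm_eq_of_hilbertBasis (hf r).1 (hf r).2 (hψ r).1 (hψ r).2 ha hab ha' hab' Y f₁ f₂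

/-- **(W2-type) Removing the ultraviolet cutoff**: for every bounded `K` and every Hilbert basis `(f_i)` of
`L²(ℝ)_ev`, `Σ_i ⟨f_i, ϑ(g) Q P̂⁰_M K f_i⟩ → Σ_i ⟨f_i, ϑ(g) Q K f_i⟩` as `M → ∞`. [cite: Connes1999, §VII Thm 4 ("when `Λ → ∞`") and proof eqs. (29)–(33) (arXiv p0013); ReedSimon1972, Thm. VI.22 (e), (f), PDF p. 198] -/
theorem tendsto_tsum_inner_scalingOp_shellProj_dualCutoff
    (K : Lp ℂ 2 (volume : Measure ℝ) →L[ℂ] Lp ℂ 2 (volume : Measure ℝ)) {ι : Type*}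
    (e : HilbertBasis ι ℂ (evenPart : Submodule ℂ (Lp ℂ 2 (volume : Measure ℝ)))) :
    Tendsto (fun M : ℝ => ∑' i, ⟪((e i : evenPart) : Lp ℂ 2 (volume : Measure ℝ)),
        (scalingOp g ∘L (shellProj a b ∘L (dualCutoffProj ∅ M ∘L K))) ((e i : evenPart) : Lp ℂ 2 (volume : Measure ℝ))⟫_ℂ)
      atTop
      (𝓝 (∑' i, ⟪((e i : evenPart) : Lp ℂ 2 (volume : Measure ℝ)),
        (scalingOp g ∘L (shellProj a b ∘L K)) ((e i : evenPart) : Lp ℂ 2 (volume : Measure ℝ))⟫_ℂ)) := by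
  obtain ⟨N, f, ψ, R, hR0, hf, hψ, hdec⟩ := exists_scalingOp_shellProj_eq_sum hg hgs ha.le hab
  have ha' : 0 < a * Real.exp (-R) := mul_pos ha (Real.exp_pos _)
  have hab' : a * Real.exp (-R) ≤ b * Real.exp R :=
    (mul_le_mul_of_nonneg_right hab (Real.exp_pos _).le).trans
      (mul_le_mul_of_nonneg_left (Real.exp_le_exp.mpr (by linarith)) (ha.le.trans hab))
  have hsplit : ∀ (Y : Lp ℂ 2 (volume : Measure ℝ) →L[ℂ] Lp ℂ 2 (volume : Measure ℝ)) (i : ι),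
      ⟪((e i : evenPart) : Lp ℂ 2 (volume : Measure ℝ)),
      (scalingOp g ∘L (shellProj a b ∘L Y)) ((e i : evenPart) : Lp ℂ 2 (volume : Measure ℝ))⟫_ℂ =
      ∑ r, ⟪((e i : evenPart) : Lp ℂ 2 (volume : Measure ℝ)),
        (scalingOp (f r) ∘L shellProj (a * Real.exp (-R)) (b * Real.exp R) ∘L
          (scalingOp (ψ r) ∘L shellProj a b ∘L Y)) ((e i : evenPart) : Lp ℂ 2 (volume : Measure ℝ))⟫_ℂ :=
    fun Y i => by rw [hdec Y, sum_apply, inner_sum]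
  simp_rw [hsplit]
  have hs : ∀ (Y : Lp ℂ 2 (volume : Measure ℝ) →L[ℂ] Lp ℂ 2 (volume : Measure ℝ)) (r : Fin N),
      Summable fun i => ⟪((e i : evenPart) : Lp ℂ 2 (volume : Measure ℝ)),
        (scalingOp (f r) ∘L shellProj (a * Real.exp (-R)) (b * Real.exp R) ∘L
          (scalingOp (ψ r) ∘L shellProj a b ∘L Y)) ((e i : evenPart) : Lp ℂ 2 (volume : Measure ℝ))⟫_ℂ :=
    fun Y r => Summable.of_norm (summable_norm_inner_mainTerm (hf r).1 (hf r).2 (hψ r).1 (hψ r).2 ha hab ha' hab' Y e).1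
  have hrew : ∀ (Y : Lp ℂ 2 (volume : Measure ℝ) →L[ℂ] Lp ℂ 2 (volume : Measure ℝ)),
      (∑' i, ∑ r, ⟪((e i : evenPart) : Lp ℂ 2 (volume : Measure ℝ)),
        (scalingOp (f r) ∘L shellProj (a * Real.exp (-R)) (b * Real.exp R) ∘L
          (scalingOp (ψ r) ∘L shellProj a b ∘L Y)) ((e i : evenPart) : Lp ℂ 2 (volume : Measure ℝ))⟫_ℂ) =
      ∑ r, ∑' i, ⟪((e i : evenPart) : Lp ℂ 2 (volume : Measure ℝ)),
        (scalingOp (f r) ∘L shellProj (a * Real.exp (-R)) (b * Real.exp R) ∘L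
          (scalingOp (ψ r) ∘L shellProj a b ∘L Y)) ((e i : evenPart) : Lp ℂ 2 (volume : Measure ℝ))⟫_ℂ :=
    fun Y => Summable.tsum_finsetSum fun r _ => hs Y r
  rw [hrew K]
  have hfun : (fun M : ℝ => ∑' i, ∑ r, ⟪((e i : evenPart) : Lp ℂ 2 (volume : Measure ℝ)),
        (scalingOp (f r) ∘L shellProj (a * Real.exp (-R)) (b * Real.exp R) ∘L
          (scalingOp (ψ r) ∘L shellProj a b ∘L (dualCutoffProj ∅ M ∘L K)))
          ((e i : evenPart) : Lp ℂ 2 (volume : Measure ℝ))⟫_ℂ) =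
      fun M : ℝ => ∑ r, ∑' i, ⟪((e i : evenPart) : Lp ℂ 2 (volume : Measure ℝ)),
        (scalingOp (f r) ∘L shellProj (a * Real.exp (-R)) (b * Real.exp R) ∘L
          (scalingOp (ψ r) ∘L shellProj a b ∘L (dualCutoffProj ∅ M ∘L K)))
          ((e i : evenPart) : Lp ℂ 2 (volume : Measure ℝ))⟫_ℂ := funext fun M => hrew _
  rw [hfun]
  exact tendsto_finsetSum _ fun r _ =>
    tendsto_tsum_inner_mainTerm (hf r).1 (hf r).2 (hψ r).1 (hψ r).2 ha hab ha' hab' K e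

end Properties

end Literature.NumberTheory.Connes2026
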